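import Summits.QuantumFields.YangMills.Theorems.PoincareLipschitzLevelOneLipschitz
import Literature.MathematicalPhysics.QuantumFieldTheory.Balaban1983to89.T4WilsonGaugeFlatDirection
import HarnessLib

/-!
# Crux stmt-QuantumFields-19936 `UnitScaleTilt.HistoryTailL`, line `poincare_lipschitz` (route crux `PoincareLipschitz.BlockLipschitzL`,
# stmt-QuantumFields-23533): the `j ≥ 2` stub `stub_iteratedLipschitz` REDUCED to the stability of the `(j−1)`-fold average modulo gauge

The registered stub `stub_iteratedLipschitz` (skeleton `Cruxes/HistoryTailL/Lines/poincare_lipschitz.lean`, `j ≥ 2`) asks for a constant `CL`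
(depending on `L` only) with `|dist1(Ū^j(∂a))(U) − dist1(Ū^j(∂a))(U')| ≤ CL/√(L^j) · (Σ_{b ∈ box} dist1(U_b U'_b⁻¹)²)^{1/2}` for pairs of
level-zero `SU(2)` fields that are locally hierarchically small around the level-`j` plaquette `a`.

THE TOP STEP IS ALREADY IN THE TREE, LEVEL-GENERICALLY.  `Ū^j = avgFun ℰp ∘ Ū^{j−1}` (`Averaging.iter`, definitionally), and the sibling helper
✓`PoincareLipschitzOneStep.abs_dist1_plaqHol_avgFun_sub_le` (w5 g9) bounds ONE (0.4) averaging step at ANY level in the SUP norm on the two-block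
footprints of the four bonds of `∂a`, with constant `4(24·5L + L) = 484·L`, on fields whose level-`(j−1)` plaquettes around `∂a` are below
`θ(K−j+1)` with `(5L)²θ/4 ≤ 1/6`.  Because the top step reads `U'` only through `dist1` of a conjugation-invariant plaquette variable of a
COVARIANT average (✓`BlockAveraging.avgFun_covariant`), it may read `Ū^{j−1}(U')` through ANY level-`(j−1)` gauge copy `(Ū^{j−1}U')^h`.

THIS FILE (door, kernel-checked): `stub_iteratedLipschitz` ⟸ ONE displayed row «AVERAGE STABILITY MODULO GAUGE» — for each `L` a constant `CS`
such that for hierarchically small pairs there is a level-`(j−1)` gauge transformation `h` with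
`dist1(Ū^{j−1}(U)_b · ((Ū^{j−1}U')^h_b)⁻¹) ≤ CS/√(L^j) · (box ℓ² link distance)` on every level-`(j−1)` bond `b` of the footprint of `∂a`
(`stub_iteratedLipschitz_of_avgStabilityModGauge`, `CL := 484·L·CS`).  Ingredients: §1 level-generic torus bookkeeping (w5 g9's `exists_int_rep` /
`tdist_le_of_near` one power of `L^{j−1}` up: a level-`(j−1)` site whose block is within `{−1,0,1,2}` of `a.src` coordinatewise has scaled corner
within torus distance `9L·L^{j−1}` of `a.src·L^j`, and `(9L + 64)·L^{j−1} ≤ 64·L^j`), §2 the explicit top step modulo gauge at any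
height (`abs_dist1_iter_succ_sub_le_of_gaugeCopy`, any footprint radius `ρ`), §3 the door.

WHY THE GAUGE INFIMUM IS NOT COSMETIC (recorded for suppliers; not used below): the un-quotiented sup-stability is FALSE — for `U' := U^g` with
`g := e^Y` at the single fine site `emb^{j−1}(y)`, covariance (`iter_gaugeAct`) gives `Ū^{j−1}(U') = (Ū^{j−1}U)^{g(y)}`, so the level-`(j−1)` bonds
at `y` move by `≍ |Y|` while the box distance is `√6·dist1(e^Y)`: ratio `≍ L^{j/2}`, unbounded in `j`.  With `h := g|_{T^{(j−1)}}` the row's left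
side vanishes.  The honest remaining content of the row is Bałaban's averaging regularity modulo gauge ([Balaban1985Averaging] Props 1–3; linear
model = the tree's tube identity ✓`PoincareLipschitzLinAvgEll2.abs_curlAt_linAvgIter_le_sqrt`, rate `√L · L^{−j/2}`).

WHAT THIS IS NOT: the displayed row is NOT proved here; nothing here proves `stub_iteratedLipschitz`, the crux `BlockLipschitzL`, the crux
`HistoryTailL`, rung R3 (YM₃ on T³ — not d = 4, not infinite volume, not a mass gap, not the Clay problem) or a summit statement.
Width seat ym-ust-19936-w1 g7 (cell ym3-torus), `--supports stmt-QuantumFields-19936`.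
-/

noncomputable section

open scoped BigOperators Matrix.Norms.L2Operator

namespace Summit.QuantumFields.YangMills.Theorems.PoincareLipschitzIteratedOfAvgStability

open Literature.MathematicalPhysics.QuantumFieldTheory.Balaban1983to89
open Literature.MathematicalPhysics.QuantumFieldTheory.Balaban1983to89.T3ContinuumYM3Torus
open Literature.MathematicalPhysics.QuantumFieldTheory.Balaban1983to89.T3UnitLawDensityEML
open T4Continuum BlockAveraging AveragingRT ExpMeanLog T3UnitScaleTilt
open Summit.QuantumFields.YangMills.Theorems.PoincareLipschitzLevelOneLipschitz
  (near_of_edge_block sixth_le_half_deltaSU_two min_val_le_natAbs norm_coe_sub_le_dist1)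

/-! ## §1 Level-generic torus bookkeeping around a plaquette of `T^{(i+1)}` -/

section Geometry

variable (F : T3Family) (K : ℕ)

/-- `|T^{(0)}| = |T^{(i)}| · L^i` per direction (standing range). [folklore] -/
theorem sitesPerDir_zero_eq_mul_pow {i : ℕ} (hi : i ≤ F.m + K) :
    (F.P K).sitesPerDir 0 = (F.P K).sitesPerDir i * F.L ^ i := by
  show 2 * F.L ^ (F.m + K - 0) = 2 * F.L ^ (F.m + K - i) * F.L ^ i
  rw [Nat.sub_zero, mul_assoc, ← pow_add, Nat.sub_add_cancel hi]

/-- The level-zero torus is long compared with the scaled block neighbourhoods: `3·L^{i+1} ≤ 2L^{m+K}` once `i + 3 ≤ K`. [folklore] -/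
theorem three_mul_pow_le_sitesPerDir_zero {i : ℕ} (hiK : i + 3 ≤ K) : 11 * F.L ^ (i + 1) ≤ (F.P K).sitesPerDir 0 := by
  have hL3 : 3 ≤ F.L := (by obtain ⟨k, hk⟩ := F.hL.1; have := F.hL.2; omega)
  have hm := F.hm
  show 11 * F.L ^ (i + 1) ≤ 2 * F.L ^ (F.m + K - 0)
  rw [Nat.sub_zero]
  have h1 : F.L ^ (i + 1 + 3) ≤ F.L ^ (F.m + K) := Nat.pow_le_pow_right (by omega) (by omega)
  have h3 : 11 ≤ F.L ^ 3 := by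
    calc 11 ≤ 3 ^ 3 := by norm_num
      _ ≤ F.L ^ 3 := Nat.pow_le_pow_left hL3 3
  have h2 : 11 * F.L ^ (i + 1) ≤ F.L ^ (i + 1 + 3) := by
    calc 11 * F.L ^ (i + 1) = F.L ^ (i + 1) * 11 := by ring
      _ ≤ F.L ^ (i + 1) * F.L ^ 3 := Nat.mul_le_mul_left _ h3
      _ = F.L ^ (i + 1 + 3) := by rw [← pow_add]
  omega

/-- **INTEGER REPRESENTATIVE, LEVEL-GENERIC.**  If the block of the level-`i` site `x` has `k`-th label in `{s, s+1, s−1, s+2}`, `s = (a₀)_k`,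
then the scaled corners satisfy `x_k·L^i − s·L^{i+1} ≡ m·L^i (mod 2L^{m+K})` for an integer `m ∈ [−L, 3L−1]`. [folklore] -/
theorem exists_int_rep_level {i : ℕ} (hi : i + 1 ≤ F.m + K) (a₀ : Site (F.P K) (i + 1)) (x : Site (F.P K) i) (k : Fin (F.P K).d)
    (hx : blockOf x k = a₀ k ∨ blockOf x k = a₀ k + 1 ∨ blockOf x k = a₀ k - 1 ∨ blockOf x k = a₀ k + 2) :
    ∃ m : ℤ, -(F.L : ℤ) ≤ m ∧ m ≤ 3 * F.L - 1 ∧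
      ((((x k).val * F.L ^ i : ℕ)) : ZMod ((F.P K).sitesPerDir 0)) -
          ((((a₀ k).val * F.L ^ (i + 1) : ℕ)) : ZMod ((F.P K).sitesPerDir 0)) =
        ((m * (F.L : ℤ) ^ i : ℤ) : ZMod ((F.P K).sitesPerDir 0)) := by
  have hPL : (F.P K).L = F.L := rfl
  have hi' : i + 1 ≤ (F.P K).m + (F.P K).K := hi
  set N0 : ℕ := (F.P K).sitesPerDir 0 with hN0
  set Ni : ℕ := (F.P K).sitesPerDir i with hNi
  set Ni1 : ℕ := (F.P K).sitesPerDir (i + 1) with hNi1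
  have hN : Ni = Ni1 * F.L := by rw [hNi, hNi1, ← hPL]; exact (F.P K).sitesPerDir_eq_mul_succ hi'
  have hN0i : N0 = Ni * F.L ^ i := by rw [hN0, hNi]; exact sitesPerDir_zero_eq_mul_pow F K (by omega)
  have hN0' : (N0 : ℤ) = (Ni1 : ℤ) * F.L * F.L ^ i := by rw [hN0i, hN]; push_cast; ring
  have hL0 : 0 < F.L := by have := F.hL.2; omega
  set v : ℕ := (x k).val with hv
  set u : ℕ := (blockOf x k).val with hu
  set t : ℕ := (a₀ k).val with ht
  have huv : u = v / F.L := by rw [hu, hv, ← hPL]; exact Site.val_blockOf hi' x k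
  -- the offset `e ∈ {0, 1, -1, 2}` with `u ≡ t + e (mod Ni1)`
  obtain ⟨e, he1, he2, hdvd⟩ : ∃ e : ℤ, -1 ≤ e ∧ e ≤ 2 ∧ (Ni1 : ℤ) ∣ (u : ℤ) - (t + e) := by
    have hcast : ∀ e : ℤ, blockOf x k = a₀ k + (e : ZMod Ni1) → (Ni1 : ℤ) ∣ (u : ℤ) - (t + e) := by
      intro e h
      have h' : ((u : ℤ) : ZMod Ni1) = (((t : ℤ) + e : ℤ) : ZMod Ni1) := by
        push_cast
        rw [hu, ht, ZMod.natCast_zmod_val, ZMod.natCast_zmod_val]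
        exact h
      have := (ZMod.intCast_eq_intCast_iff_dvd_sub _ _ _).1 h'.symm
      simpa using this
    rcases hx with h | h | h | h
    · exact ⟨0, by norm_num, by norm_num, hcast 0 (by simpa using h)⟩
    · exact ⟨1, by norm_num, by norm_num, hcast 1 (by simpa using h)⟩
    · exact ⟨-1, by norm_num, by norm_num, hcast (-1) (by rw [h]; push_cast; ring)⟩
    · exact ⟨2, by norm_num, by norm_num, hcast 2 (by simpa using h)⟩
  -- `v = uL + r`, `0 ≤ r < L`
  set r : ℕ := v % F.L with hr
  have hvdec : (v : ℤ) = u * F.L + r := by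
    have h1 : F.L * (v / F.L) + v % F.L = v := Nat.div_add_mod v F.L
    rw [← huv] at h1
    have h2 : (v : ℤ) = ((F.L * u + r : ℕ) : ℤ) := by rw [h1]
    rw [h2]; push_cast; ring
  have hrL : (r : ℤ) ≤ F.L - 1 := by have : r < F.L := Nat.mod_lt _ hL0; omega
  have hr0 : (0 : ℤ) ≤ r := by positivity
  have hL1 : (1 : ℤ) ≤ F.L := by exact_mod_cast hL0
  refine ⟨r + e * F.L, by nlinarith, by nlinarith, ?_⟩
  -- `x_k L^i − t L^{i+1} = ((u − t − e)L)·L^i + (r + eL)L^i ≡ (r + eL)L^i (mod N0)`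
  rw [show ((((x k).val * F.L ^ i : ℕ)) : ZMod N0) = (((v : ℤ) * F.L ^ i : ℤ) : ZMod N0) by rw [hv]; push_cast; rfl,
    show ((((a₀ k).val * F.L ^ (i + 1) : ℕ)) : ZMod N0) = (((t : ℤ) * F.L ^ (i + 1) : ℤ) : ZMod N0) by rw [ht]; push_cast; rfl,
    ← Int.cast_sub, ZMod.intCast_eq_intCast_iff_dvd_sub]
  obtain ⟨q, hq⟩ := hdvd
  exact ⟨-q, by rw [hvdec, hN0']; linear_combination (-(F.L : ℤ) * (F.L : ℤ) ^ i) * hq⟩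

variable {F K}

/-- **TORUS DISTANCE TO THE CORNER, LEVEL-GENERIC.**  A level-`i` site whose block is within `{−1,0,1,2}` of `a₀` coordinatewise has scaled corner
within torus distance `9L·L^i` of `a₀·L^{i+1}` (`i + 3 ≤ K`). [folklore] -/
theorem tdist_le_of_near_level {i : ℕ} (hiK : i + 3 ≤ K) (a₀ : Site (F.P K) (i + 1)) (x : Site (F.P K) i)
    (hx : ∀ k, blockOf x k = a₀ k ∨ blockOf x k = a₀ k + 1 ∨ blockOf x k = a₀ k - 1 ∨ blockOf x k = a₀ k + 2) :
    Site.tdist (fun k => ((((x k).val * F.L ^ i : ℕ)) : ZMod ((F.P K).sitesPerDir 0)))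
        (fun k => ((((a₀ k).val * F.L ^ (i + 1) : ℕ)) : ZMod ((F.P K).sitesPerDir 0))) ≤ 9 * F.L * F.L ^ i := by
  have hL3 : 3 ≤ F.L := (by obtain ⟨k, hk⟩ := F.hL.1; have := F.hL.2; omega)
  have hm := F.hm
  have hi : i + 1 ≤ F.m + K := by omega
  have hbig := three_mul_pow_le_sitesPerDir_zero F K hiK
  have hLi : 0 < F.L ^ i := pow_pos (by omega) i
  unfold Site.tdist
  have hd : (F.P K).d = 3 := rfl
  calc ∑ μ : Fin (F.P K).d, min ((((((x μ).val * F.L ^ i : ℕ)) : ZMod ((F.P K).sitesPerDir 0)) -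
            ((((a₀ μ).val * F.L ^ (i + 1) : ℕ)) : ZMod ((F.P K).sitesPerDir 0))).val)
          ((((((a₀ μ).val * F.L ^ (i + 1) : ℕ)) : ZMod ((F.P K).sitesPerDir 0)) -
            ((((x μ).val * F.L ^ i : ℕ)) : ZMod ((F.P K).sitesPerDir 0))).val)
      ≤ ∑ _μ : Fin (F.P K).d, (3 * F.L * F.L ^ i) := by
        refine Finset.sum_le_sum fun k _ => ?_
        obtain ⟨m, hm1, hm2, hmeq⟩ := exists_int_rep_level F K hi a₀ x k (hx k)
        have hmabs0 : m.natAbs ≤ 3 * F.L := by omega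
        have hmabs : (m * (F.L : ℤ) ^ i).natAbs ≤ 3 * F.L * F.L ^ i := by
          rw [Int.natAbs_mul, Int.natAbs_pow, Int.natAbs_natCast]
          exact Nat.mul_le_mul_right _ hmabs0
        have hmN : (m * (F.L : ℤ) ^ i).natAbs < (F.P K).sitesPerDir 0 := by
          have : 3 * F.L * F.L ^ i < 11 * F.L ^ (i + 1) := by
            rw [pow_succ]; nlinarith
          omega
        rw [← neg_sub (((((x k).val * F.L ^ i : ℕ)) : ZMod ((F.P K).sitesPerDir 0))), hmeq]
        exact (min_val_le_natAbs _ hmN).trans hmabs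
    _ = 9 * F.L * F.L ^ i := by
        rw [Finset.sum_const, Finset.card_univ, Fintype.card_fin, hd, smul_eq_mul]; ring

/-- **THE LOCAL WINDOW CONTAINS THE BLOCKS AROUND `∂a`, LEVEL-GENERIC**: for `i + 3 ≤ K`, a level-`i` site whose block is within `{−1,0,1,2}` of `a₀`
coordinatewise satisfies the crux's window inequality `tdist + 64·L^i ≤ 64·L^{i+1}` (`(9L + 64)·L^i ≤ 64L·L^i` as `L ≥ 2`). [folklore] -/
theorem tdist_add_le_of_near_level {i : ℕ} (hiK : i + 3 ≤ K) (a₀ : Site (F.P K) (i + 1)) (x : Site (F.P K) i)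
    (hx : ∀ k, blockOf x k = a₀ k ∨ blockOf x k = a₀ k + 1 ∨ blockOf x k = a₀ k - 1 ∨ blockOf x k = a₀ k + 2) :
    Site.tdist (fun k => ((((x k).val * F.L ^ i : ℕ)) : ZMod ((F.P K).sitesPerDir 0)))
        (fun k => ((((a₀ k).val * F.L ^ (i + 1) : ℕ)) : ZMod ((F.P K).sitesPerDir 0))) + 64 * F.L ^ i ≤ 64 * F.L ^ (i + 1) := by
  have h := tdist_le_of_near_level hiK a₀ x hx
  have hL3 : 3 ≤ F.L := (by obtain ⟨k, hk⟩ := F.hL.1; have := F.hL.2; omega)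
  have hLi : 0 < F.L ^ i := pow_pos (by omega) i
  have h2 : (9 * F.L + 64) * F.L ^ i ≤ (64 * F.L) * F.L ^ i := Nat.mul_le_mul_right _ (by omega)
  have e : 64 * F.L ^ (i + 1) = 64 * F.L * F.L ^ i := by rw [pow_succ]; ring
  rw [e]
  linarith

end Geometry

/-! ## §2 The top step modulo gauge, at any height -/

section TopStep

variable {F : T3Family} {K j : ℕ} {γ b₀ p₀ : ℝ}

/-- **THE TOP STEP READS `U'` THROUGH ANY GAUGE COPY OF ITS `j`-FOLD AVERAGE** (explicit form, any height `j`, `j + 3 ≤ K`): if `U, U'` are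
locally hierarchically small around the level-`(j+1)` plaquette `a` up to height `j`, the threshold at height `K − j` is `≤ 1/(75(L+1)²)`, and for
SOME level-`j` gauge transformation `h` the fields `Ū^j(U)` and `(Ū^j U')^h` are within `ρ` in `dist1` on every level-`j` bond of the two-block
footprints of the four bonds of `∂a`, then `|dist1(Ū^{j+1}(∂a))(U) − dist1(Ū^{j+1}(∂a))(U')| ≤ 484·L·ρ`.  (✓`PoincareLipschitzOneStep.abs_dist1_plaqHol_avgFun_sub_le`
at height `j`; ✓`avgFun_covariant`; `Averaging.iter … (j+1) = avgFun ℰp ∘ Averaging.iter … j` definitionally.) [cite: Balaban1987RG1, (0.4) p.253; Balaban1985Averaging, (11) p.19] -/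
theorem abs_dist1_iter_succ_sub_le_of_gaugeCopy (hjK : j + 3 ≤ K) (hγ : 0 < γ) (hγ1 : γ ≤ 1) (hb : 0 < b₀)
    (hθσ : θBal F.L γ b₀ p₀ (K - j) ≤ 1 / (75 * ((F.L : ℝ) + 1) ^ 2))
    (a : Plaq (F.P K) (j + 1)) (U U' : GaugeField (F.P K) 0 (Matrix.specialUnitaryGroup (Fin 2) ℂ))
    (hU : (∀ (i : ℕ) (q : Plaq (F.P K) i), i < j + 1 → Site.tdist (fun k => ((((q.src k).val * F.L ^ i : ℕ)) : ZMod ((F.P K).sitesPerDir 0))) (fun k => ((((a.src k).val * F.L ^ (j + 1) : ℕ)) : ZMod ((F.P K).sitesPerDir 0))) + 64 * F.L ^ i ≤ 64 * F.L ^ (j + 1) → GaugeGroup.dist1 (GaugeField.plaqHol (Averaging.iter (fun i' => BlockAveraging.blockAvg (P := F.P K) (j := i') T3UnitLawDensityEML.ℰp) i U) q) < T3UnitScaleTilt.θBal F.L γ b₀ p₀ (K - i)))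
    (hU' : (∀ (i : ℕ) (q : Plaq (F.P K) i), i < j + 1 → Site.tdist (fun k => ((((q.src k).val * F.L ^ i : ℕ)) : ZMod ((F.P K).sitesPerDir 0))) (fun k => ((((a.src k).val * F.L ^ (j + 1) : ℕ)) : ZMod ((F.P K).sitesPerDir 0))) + 64 * F.L ^ i ≤ 64 * F.L ^ (j + 1) → GaugeGroup.dist1 (GaugeField.plaqHol (Averaging.iter (fun i' => BlockAveraging.blockAvg (P := F.P K) (j := i') T3UnitLawDensityEML.ℰp) i U') q) < T3UnitScaleTilt.θBal F.L γ b₀ p₀ (K - i)))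
    (h : GaugeTransf (F.P K) j (Matrix.specialUnitaryGroup (Fin 2) ℂ)) {ρ : ℝ} (hρ : 0 ≤ ρ)
    (hh : ∀ c : PBond (F.P K) (j + 1), (c = ⟨a.src, a.μ⟩ ∨ c = ⟨a.src.shift a.μ, a.ν⟩ ∨ c = ⟨a.src.shift a.ν, a.μ⟩ ∨ c = ⟨a.src, a.ν⟩) → ∀ b : PBond (F.P K) j, (blockOf b.src = c.src ∨ blockOf b.src = c.tgt) → (blockOf b.tgt = c.src ∨ blockOf b.tgt = c.tgt) → GaugeGroup.dist1 (Averaging.iter (fun i' => BlockAveraging.blockAvg (P := F.P K) (j := i') T3UnitLawDensityEML.ℰp) j U b * (GaugeField.gaugeAct h (Averaging.iter (fun i' => BlockAveraging.blockAvg (P := F.P K) (j := i') T3UnitLawDensityEML.ℰp) j U') b)⁻¹) ≤ ρ) :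
    |GaugeGroup.dist1 (GaugeField.plaqHol (Averaging.iter (fun i' => BlockAveraging.blockAvg (P := F.P K) (j := i') T3UnitLawDensityEML.ℰp) (j + 1) U) a) -
        GaugeGroup.dist1 (GaugeField.plaqHol (Averaging.iter (fun i' => BlockAveraging.blockAvg (P := F.P K) (j := i') T3UnitLawDensityEML.ℰp) (j + 1) U') a)| ≤ 484 * F.L * ρ := by
  have hL3 : 3 ≤ F.L := (by obtain ⟨k, hk⟩ := F.hL.1; have := F.hL.2; omega)
  have hjr : j + 1 ≤ (F.P K).m + (F.P K).K := by
    show j + 1 ≤ F.m + K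
    have := F.hm; omega
  -- the top step, definitionally
  have hiU : Averaging.iter (fun i' => BlockAveraging.blockAvg (P := F.P K) (j := i') T3UnitLawDensityEML.ℰp) (j + 1) U =
      avgFun ℰp (Averaging.iter (fun i' => BlockAveraging.blockAvg (P := F.P K) (j := i') T3UnitLawDensityEML.ℰp) j U) := rfl
  have hiU' : Averaging.iter (fun i' => BlockAveraging.blockAvg (P := F.P K) (j := i') T3UnitLawDensityEML.ℰp) (j + 1) U' =
      avgFun ℰp (Averaging.iter (fun i' => BlockAveraging.blockAvg (P := F.P K) (j := i') T3UnitLawDensityEML.ℰp) j U') := rfl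
  -- read `U'` through the gauge copy `(Ū^j U')^h`
  have hcov : dist1 (GaugeField.plaqHol (avgFun ℰp (GaugeField.gaugeAct h (Averaging.iter (fun i' => BlockAveraging.blockAvg (P := F.P K) (j := i') T3UnitLawDensityEML.ℰp) j U'))) a) =
      dist1 (GaugeField.plaqHol (avgFun ℰp (Averaging.iter (fun i' => BlockAveraging.blockAvg (P := F.P K) (j := i') T3UnitLawDensityEML.ℰp) j U')) a) := by
    rw [avgFun_covariant ℰp hjr h _, T4WilsonGaugeFlatDirection.plaqHol_gaugeAct, GaugeGroup.dist1_conj]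
  rw [hiU, hiU', ← hcov]
  -- the threshold at height `K − j` and the half-guard
  have hθ0 : 0 ≤ θBal F.L γ b₀ p₀ (K - j) := (T3MinimiserStabilityReduction.θBal_pos (by omega) hγ hγ1 hb p₀ (K - j)).le
  have hθδ : ((((F.P K).d + 2) * (F.P K).L : ℕ) : ℝ) ^ 2 / 4 * θBal F.L γ b₀ p₀ (K - j) ≤ deltaSU (Fin 2) / 2 := by
    have e5 : ((((F.P K).d + 2) * (F.P K).L : ℕ) : ℝ) = 5 * F.L := by
      show ((((3 + 2) * F.L : ℕ)) : ℝ) = 5 * F.L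
      push_cast; ring
    rw [e5]
    have h1 : (5 * (F.L : ℝ)) ^ 2 / 4 * (1 / (75 * ((F.L : ℝ) + 1) ^ 2)) = (F.L : ℝ) ^ 2 / (12 * ((F.L : ℝ) + 1) ^ 2) := by
      field_simp; ring
    have h2 : (F.L : ℝ) ^ 2 / (12 * ((F.L : ℝ) + 1) ^ 2) ≤ 1 / 6 := by
      rw [div_le_div_iff₀ (by positivity) (by norm_num)]
      nlinarith
    calc (5 * (F.L : ℝ)) ^ 2 / 4 * θBal F.L γ b₀ p₀ (K - j) ≤ (5 * (F.L : ℝ)) ^ 2 / 4 * (1 / (75 * ((F.L : ℝ) + 1) ^ 2)) :=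
          mul_le_mul_of_nonneg_left hθσ (by positivity)
      _ ≤ 1 / 6 := by rw [h1]; exact h2
      _ ≤ deltaSU (Fin 2) / 2 := sixth_le_half_deltaSU_two
  -- the local smallness hypotheses at height `j`, read on the blocks around `∂a`
  have hloc : ∀ Z : GaugeField (F.P K) 0 (Matrix.specialUnitaryGroup (Fin 2) ℂ),
      (∀ (i : ℕ) (q : Plaq (F.P K) i), i < j + 1 → Site.tdist (fun k => ((((q.src k).val * F.L ^ i : ℕ)) : ZMod ((F.P K).sitesPerDir 0))) (fun k => ((((a.src k).val * F.L ^ (j + 1) : ℕ)) : ZMod ((F.P K).sitesPerDir 0))) + 64 * F.L ^ i ≤ 64 * F.L ^ (j + 1) → GaugeGroup.dist1 (GaugeField.plaqHol (Averaging.iter (fun i' => BlockAveraging.blockAvg (P := F.P K) (j := i') T3UnitLawDensityEML.ℰp) i Z) q) < T3UnitScaleTilt.θBal F.L γ b₀ p₀ (K - i)) →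
      ∀ c : PBond (F.P K) (j + 1), (c = ⟨a.src, a.μ⟩ ∨ c = ⟨a.src.shift a.μ, a.ν⟩ ∨ c = ⟨a.src.shift a.ν, a.μ⟩ ∨ c = ⟨a.src, a.ν⟩) →
        ∀ q : Plaq (F.P K) j, (blockOf q.src = c.src.unshift c.dir ∨ blockOf q.src = c.src ∨ blockOf q.src = c.tgt) →
          dist1 (GaugeField.plaqHol (Averaging.iter (fun i' => BlockAveraging.blockAvg (P := F.P K) (j := i') T3UnitLawDensityEML.ℰp) j Z) q) < θBal F.L γ b₀ p₀ (K - j) := by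
    intro Z hZ c hc q hq
    have hnear : ∀ k, blockOf q.src k = a.src k ∨ blockOf q.src k = a.src k + 1 ∨ blockOf q.src k = a.src k - 1 ∨
        blockOf q.src k = a.src k + 2 := fun k => near_of_edge_block a c hc (blockOf q.src) hq k
    exact hZ j q (Nat.lt_succ_self j) (tdist_add_le_of_near_level hjK a.src q.src hnear)
  have hlocW : ∀ c : PBond (F.P K) (j + 1), (c = ⟨a.src, a.μ⟩ ∨ c = ⟨a.src.shift a.μ, a.ν⟩ ∨ c = ⟨a.src.shift a.ν, a.μ⟩ ∨ c = ⟨a.src, a.ν⟩) →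
      ∀ q : Plaq (F.P K) j, (blockOf q.src = c.src.unshift c.dir ∨ blockOf q.src = c.src ∨ blockOf q.src = c.tgt) →
        dist1 (GaugeField.plaqHol (GaugeField.gaugeAct h (Averaging.iter (fun i' => BlockAveraging.blockAvg (P := F.P K) (j := i') T3UnitLawDensityEML.ℰp) j U')) q) < θBal F.L γ b₀ p₀ (K - j) := by
    intro c hc q hq
    rw [T4WilsonGaugeFlatDirection.plaqHol_gaugeAct, GaugeGroup.dist1_conj]
    exact hloc U' hU' c hc q hq
  -- the footprint distance in the matrix norm
  have hVW : ∀ c : PBond (F.P K) (j + 1), (c = ⟨a.src, a.μ⟩ ∨ c = ⟨a.src.shift a.μ, a.ν⟩ ∨ c = ⟨a.src.shift a.ν, a.μ⟩ ∨ c = ⟨a.src, a.ν⟩) →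
      ∀ b : PBond (F.P K) j, (blockOf b.src = c.src ∨ blockOf b.src = c.tgt) → (blockOf b.tgt = c.src ∨ blockOf b.tgt = c.tgt) →
        ‖((Averaging.iter (fun i' => BlockAveraging.blockAvg (P := F.P K) (j := i') T3UnitLawDensityEML.ℰp) j U b : Matrix.specialUnitaryGroup (Fin 2) ℂ) : Matrix (Fin 2) (Fin 2) ℂ) -
            ((GaugeField.gaugeAct h (Averaging.iter (fun i' => BlockAveraging.blockAvg (P := F.P K) (j := i') T3UnitLawDensityEML.ℰp) j U') b : Matrix.specialUnitaryGroup (Fin 2) ℂ) : Matrix (Fin 2) (Fin 2) ℂ)‖ ≤ ρ :=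
    fun c hc b hbs hbt => (norm_coe_sub_le_dist1 _ _).trans (hh c hc b hbs hbt)
  -- the one-step estimate at height `j`
  have key := PoincareLipschitzOneStep.abs_dist1_plaqHol_avgFun_sub_le (n := Fin 2) hjr
    (Averaging.iter (fun i' => BlockAveraging.blockAvg (P := F.P K) (j := i') T3UnitLawDensityEML.ℰp) j U) (GaugeField.gaugeAct h (Averaging.iter (fun i' => BlockAveraging.blockAvg (P := F.P K) (j := i') T3UnitLawDensityEML.ℰp) j U')) a hθ0 hθδ (hloc U hU) hlocW hρ hVW
  refine key.trans (le_of_eq ?_)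
  have e5 : ((((F.P K).d + 2) * (F.P K).L : ℕ) : ℝ) = 5 * F.L := by
    show ((((3 + 2) * F.L : ℕ)) : ℝ) = 5 * F.L
    push_cast; ring
  have ePL : ((F.P K).L : ℝ) = F.L := rfl
  rw [e5, ePL]
  ring

end TopStep

/-! ## §3 The door: `stub_iteratedLipschitz` from the stability of the `(j−1)`-fold average modulo gauge -/

section Door

/-- ★ **`stub_iteratedLipschitz` ⟸ AVERAGE STABILITY MODULO GAUGE.**  If for each `L` there is `CS ≥ 0` such that (for all thresholds, a
`γ₁`, all families with `F.L = L`, all `1 ≤ j`, `j + 3 ≤ K`, every level-`(j+1)` plaquette `a` and every pair of level-zero `SU(2)` fields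
locally hierarchically small around `a`) SOME level-`j` gauge copy of `Ū^j(U')` is within `CS/√(L^{j+1})·(box ℓ² link distance)` of `Ū^j(U)` in
`dist1` on every level-`j` bond of the two-block footprints of the four bonds of `∂a`, then the registered stub `stub_iteratedLipschitz` holds
VERBATIM with `CL := 484·L·CS` (`abs_dist1_iter_succ_sub_le_of_gaugeCopy` + ✓`T3Thresholds.exists_gamma_forall_θBal_le`).
[cite: Balaban1987RG1, (0.4) p.253; Balaban1985Averaging, (11) p.19] -/
theorem stub_iteratedLipschitz_of_avgStabilityModGauge
    (hStab : open Literature.MathematicalPhysics.QuantumFieldTheory.Balaban1983to89 Literature.MathematicalPhysics.QuantumFieldTheory.Balaban1983to89.T3ContinuumYM3Torus in ∀ (L : ℕ), ∃ CS : ℝ, 0 ≤ CS ∧ ∀ (b₀ p₀ : ℝ), 0 < b₀ → 2 < p₀ → ∃ γ₁ : ℝ, 0 < γ₁ ∧ γ₁ ≤ 1 ∧ ∀ (F : T3Family) (γ : ℝ), F.L = L → 0 < γ → γ ≤ γ₁ → ∀ (K j : ℕ), 1 ≤ j → j + 3 ≤ K → ∀ (a : Plaq (F.P K) (j + 1)) (U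 U' : GaugeField (F.P K) 0 (Matrix.specialUnitaryGroup (Fin 2) ℂ)), (∀ (i : ℕ) (q : Plaq (F.P K) i), i < j + 1 → Site.tdist (fun k => ((((q.src k).val * F.L ^ i : ℕ)) : ZMod ((F.P K).sitesPerDir 0))) (fun k => ((((a.src k).val * F.L ^ (j + 1) : ℕ)) : ZMod ((F.P K).sitesPerDir 0))) + 64 * F.L ^ i ≤ 64 * F.L ^ (j + 1) → GaugeGroup.dist1 (GaugeField.plaqHol (Averaging.iter (fun i' => BlockAveraging.blockAvg (P := F.P K) (j := i') T3UnitLawDensityEML.ℰp) i U) q) < T3UnitScaleTilt.θBal F.L γ b₀ p₀ (K - i)) → (∀ (i : ℕ) (q : Plaq (F.P K) i), i < j + 1 → Site.tdist (fun k => ((((q.src k).val * F.L ^ i : ℕ)) : ZMod ((F.P K).sitesPerDir 0))) (fun k => ((((a.src k).val * F.L ^ (j + 1) : ℕ)) : ZMod ((F.P K).sitesPerDir 0))) + 64 * F.L ^ i ≤ 64 * F.L ^ (j + 1) → GaugeGroup.dist1 (GaugeField.plaqHol (Averaging.iter (fun i' => BlockAveraging.blockAvg (P := F.P K) (j := i')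 T3UnitLawDensityEML.ℰp) i U') q) < T3UnitScaleTilt.θBal F.L γ b₀ p₀ (K - i)) → ∃ h : GaugeTransf (F.P K) j (Matrix.specialUnitaryGroup (Fin 2) ℂ), ∀ c : PBond (F.P K) (j + 1), (c = ⟨a.src, a.μ⟩ ∨ c = ⟨a.src.shift a.μ, a.ν⟩ ∨ c = ⟨a.src.shift a.ν, a.μ⟩ ∨ c = ⟨a.src, a.ν⟩) → ∀ b : PBond (F.P K) j, (blockOf b.src = c.src ∨ blockOf b.src = c.tgt) → (blockOf b.tgt = c.src ∨ blockOf b.tgt = c.tgt) → GaugeGroup.dist1 (Averaging.iter (fun i' => BlockAveraging.blockAvg (P := F.P K) (j := i') T3UnitLawDensityEML.ℰp) j U b * (GaugeField.gaugeAct h (Averaging.iter (fun i' => BlockAveraging.blockAvg (P := F.P K) (j := i') T3UnitLawDensityEML.ℰp) j U') b)⁻¹) ≤ CS / Real.sqrt ((F.L : ℝ) ^ (j + 1)) * Real.sqrt (∑ b : PBond (F.P K) 0, if (∀ k, (b.src k - ((((a.src k).val * F.L ^ (j + 1) : ℕ)) : ZMod ((F.P K).sitesPerDir 0)) + ((8 *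 F.L ^ (j + 1) : ℕ) : ZMod ((F.P K).sitesPerDir 0))).val < 17 * F.L ^ (j + 1)) ∧ (∀ k, (b.tgt k - ((((a.src k).val * F.L ^ (j + 1) : ℕ)) : ZMod ((F.P K).sitesPerDir 0)) + ((8 * F.L ^ (j + 1) : ℕ) : ZMod ((F.P K).sitesPerDir 0))).val < 17 * F.L ^ (j + 1)) then GaugeGroup.dist1 (U b * (U' b)⁻¹) ^ 2 else 0)) :
    open Literature.MathematicalPhysics.QuantumFieldTheory.Balaban1983to89 Literature.MathematicalPhysics.QuantumFieldTheory.Balaban1983to89.T3ContinuumYM3Torus in ∀ (L : ℕ), ∃ CL : ℝ, 0 ≤ CL ∧ ∀ (b₀ p₀ : ℝ), 0 < b₀ → 2 < p₀ → ∃ γ₁ : ℝ, 0 < γ₁ ∧ γ₁ ≤ 1 ∧ ∀ (F : T3Family) (γ : ℝ), F.L = L → 0 < γ → γ ≤ γ₁ → ∀ (K j : ℕ), 1 ≤ j → j + 2 ≤ K → 2 ≤ j → ∀ (a : Plaq (F.P K) j) (U U' : GaugeField (F.P K) 0 (Matrix.specialUnitaryGroup (Fin 2) ℂ)), (∀ (i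 : ℕ) (q : Plaq (F.P K) i), i < j → Site.tdist (fun k => ((((q.src k).val * F.L ^ i : ℕ)) : ZMod ((F.P K).sitesPerDir 0))) (fun k => ((((a.src k).val * F.L ^ j : ℕ)) : ZMod ((F.P K).sitesPerDir 0))) + 64 * F.L ^ i ≤ 64 * F.L ^ j → GaugeGroup.dist1 (GaugeField.plaqHol (Averaging.iter (fun i' => BlockAveraging.blockAvg (P := F.P K) (j := i') T3UnitLawDensityEML.ℰp) i U) q) < T3UnitScaleTilt.θBal F.L γ b₀ p₀ (K - i)) → (∀ (i : ℕ) (q : Plaq (F.P K) i), i < j → Site.tdist (fun k => ((((q.src k).val * F.L ^ i : ℕ)) : ZMod ((F.P K).sitesPerDir 0))) (fun k => ((((a.src k).val * F.L ^ j : ℕ)) : ZMod ((F.P K).sitesPerDir 0))) + 64 * F.L ^ i ≤ 64 * F.L ^ j → GaugeGroup.dist1 (GaugeField.plaqHol (Averaging.iter (fun i' => BlockAveraging.blockAvg (P := F.P K) (j := i') T3UnitLawDensityEML.ℰp) i U') q) < T3UnitScaleTilt.θBal F.L γ b₀ p₀ (K - i)) → |GaugeGroup.dist1 (GaugeField.plaqHol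 (Averaging.iter (fun i' => BlockAveraging.blockAvg (P := F.P K) (j := i') T3UnitLawDensityEML.ℰp) j U) a) - GaugeGroup.dist1 (GaugeField.plaqHol (Averaging.iter (fun i' => BlockAveraging.blockAvg (P := F.P K) (j := i') T3UnitLawDensityEML.ℰp) j U') a)| ≤ CL / Real.sqrt ((F.L : ℝ) ^ j) * Real.sqrt (∑ b : PBond (F.P K) 0, if (∀ k, (b.src k - ((((a.src k).val * F.L ^ j : ℕ)) : ZMod ((F.P K).sitesPerDir 0)) + ((8 * F.L ^ j : ℕ) : ZMod ((F.P K).sitesPerDir 0))).val < 17 * F.L ^ j) ∧ (∀ k, (b.tgt k - ((((a.src k).val * F.L ^ j : ℕ)) : ZMod ((F.P K).sitesPerDir 0)) + ((8 * F.L ^ j : ℕ) : ZMod ((F.P K).sitesPerDir 0))).val < 17 * F.L ^ j) then GaugeGroup.dist1 (U b * (U' b)⁻¹) ^ 2 else 0) := by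
  intro L
  obtain ⟨CS, hCS, HS⟩ := hStab L
  refine ⟨484 * L * CS, by positivity, ?_⟩
  intro b₀ p₀ hb hp
  obtain ⟨γa, hγa, hγa1, HS'⟩ := HS b₀ p₀ hb hp
  obtain ⟨γt, hγt, hγt1, hθσ⟩ := T3Thresholds.exists_gamma_forall_θBal_le (b₀ := b₀) (p₀ := p₀) hb (by linarith)
    (σ := 1 / (75 * ((L : ℝ) + 1) ^ 2)) (by positivity)
  refine ⟨min γa γt, lt_min hγa hγt, (min_le_left _ _).trans hγa1, ?_⟩
  intro F γ hFL hγ hγ1 K j hj1 hjK hj2 a U U' hU hU'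
  obtain ⟨j, rfl⟩ : ∃ j', j = j' + 1 := ⟨j - 1, by omega⟩
  subst hFL
  have hL3 : 3 ≤ F.L := (by obtain ⟨k, hk⟩ := F.hL.1; have := F.hL.2; omega)
  obtain ⟨h, hh⟩ := HS' F γ rfl hγ (hγ1.trans (min_le_left _ _)) K j (by omega) (by omega) a U U' hU hU'
  have hρ0 : 0 ≤ CS / Real.sqrt ((F.L : ℝ) ^ (j + 1)) * Real.sqrt (∑ b : PBond (F.P K) 0, if (∀ k, (b.src k - ((((a.src k).val * F.L ^ (j + 1) : ℕ)) : ZMod ((F.P K).sitesPerDir 0)) + ((8 * F.L ^ (j + 1) : ℕ) : ZMod ((F.P K).sitesPerDir 0))).val < 17 * F.L ^ (j + 1)) ∧ (∀ k, (b.tgt k - ((((a.src k).val * F.L ^ (j + 1) : ℕ)) : ZMod ((F.P K).sitesPerDir 0)) + ((8 * F.L ^ (j + 1) : ℕ) : ZMod ((F.P K).sitesPerDir 0))).val < 17 * F.L ^ (j + 1)) then GaugeGroup.dist1 (U b * (U' b)⁻¹) ^ 2 else 0) :=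
    mul_nonneg (div_nonneg hCS (Real.sqrt_nonneg _)) (Real.sqrt_nonneg _)
  have key := abs_dist1_iter_succ_sub_le_of_gaugeCopy (by omega) hγ (hγ1.trans ((min_le_left _ _).trans hγa1)) hb
    (hθσ F.L (by omega) γ hγ (hγ1.trans (min_le_right _ _)) (K - j)) a U U' hU hU' h hρ0 hh
  refine key.trans (le_of_eq ?_)
  ring

end Door

end Summit.QuantumFields.YangMills.Theorems.PoincareLipschitzIteratedOfAvgStability
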